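import Summits.QuantumFields.YangMills.Theorems.PoincareLipschitzHSystemEnergyIdentityLetters
import Summits.QuantumFields.YangMills.Theorems.PoincareLipschitzHSystemEnergyIdentityCutoff
import HarnessLib

/-!
# Crux `BlockLipschitzL` (stmt-QuantumFields-23533) ∕ `HistoryTailL` (stmt-QuantumFields-19936), LINE 25 «CompactnessTransfer»,
# stub S1″ — ROAD (W) «the (GAP) with no named fact», brick (W-EN) — file 3 «THE H-SYSTEM ENERGY IDENTITY BY CUT-OFF»

Cell `ym3-torus` (YM ladder rung R3 = continuum SU(2) Yang–Mills on T³ — a RUNG, NOT Clay: not d = 4, not infinite volume,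
not a mass gap); WIDTH helper seat `ym3-torus-px3` g10 (brick (W-EN) of ★w3-19936 g16's road memo `ROAD-W-WENTE-3PI-w3g16.md`);
`--supports stmt-QuantumFields-23533`; THEOREMS ONLY (0 `def`, 0 `sorry`, default heartbeats); imports file 1
✓`PoincareLipschitzHSystemEnergyIdentityLetters` (the row tested with `χ²(u − c)`) and file 2 ✓`PoincareLipschitzHSystemEnergyIdentityCutoff`
(scaled cut-offs, cross term, tail).

WHAT THIS FILE PROVES (`E² = EuclideanSpace ℝ (Fin 2)`, `E³ = EuclideanSpace ℝ (Fin 3)`, `e k = EuclideanSpace.single k 1`,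
`(B_x ∧ B_y)^a = (GB e₀)^{a+1}(GB e₁)^{a+2} − (GB e₀)^{a+2}(GB e₁)^{a+1}`, indices mod 3).
* §3 ★★ `energy_identity_scalar` — for `u` continuous, bounded, weakly differentiable on the plane with `∂_k u ∈ L²`, and `J ∈ L¹`
  with `−∫ Σ_k ∂_kη ∂_k u = 2∫ η J` for all smooth compactly supported `η`:  `∫ Σ_k (∂_k u)² = −2 ∫ (u − c) J` for EVERY constant `c`.
* §4 ★★★ `energy_identity_coord` ∕ `energy_identity` ∕ `energy_le` — for `B : E² → E³` with the (F) rows (i) `HasWeakFDerivOn univ B GB`,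
  (ii) `Σ_k‖GB e_k‖² ∈ L¹`, (iii) the weak `H`-system `ΔB = 2 B_x ∧ B_y` VERBATIM (★w3 g15's binder 83add449), plus `B` CONTINUOUS and
  BOUNDED (the precise representative delivered by W-ONE ∕ W-TWO): for every `c : E³`,
  `∫ Σ_k ((GB e_k)^a)² = −2 ∫ (B^a − c_a)(B_x ∧ B_y)^a`,   `Θ := ∫ Σ_k ‖GB e_k‖² = −2 Σ_a ∫ (B^a − c_a)(B_x ∧ B_y)^a`,
  and, under `|B^a − c_a| ≤ κ_a`, THE (W-EN) ROW `Θ ≤ 2 Σ_a κ_a ∫ |(B_x ∧ B_y)^a|` consumed by W-ALG.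
HONEST SCOPE.  Sobolev calculus on the plane; (W-EN) is one of four rows of ROAD (W); nothing of (GAP), (TM), S1″, K1,
`MeanDeviationL`, `BlockLipschitzL`, `HistoryTailL` is proved here.  YM₃ on T³ is rung R3, not Clay; YM gap NOT proved; no summit
statement is proved here.

References: H. C. Wente, J. Math. Anal. Appl. 26 (1969) 318–344 [Wente1969]; H. Brezis, J.-M. Coron, Arch. Rational Mech. Anal. 89
(1985) 21–56, Appendix (proof of Lemma A.1: `∫|∇ω|² = −2∫ ω·ω_x ∧ ω_y` by cut-off) [BrezisCoron1985]; L. C. Evans, Partial Differential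
Equations (2010), §5.3.1 [Evans2010].
-/

set_option autoImplicit false

noncomputable section

open MeasureTheory Set Filter Function Topology TopologicalSpace ContinuousLinearMap Metric
open scoped ContDiff ENNReal BigOperators Convolution

namespace Summit.QuantumFields.YangMills.Theorems.PoincareLipschitzHSystemEnergyIdentity

open Literature.Analysis.FunctionSpaces
open Summit.QuantumFields.YangMills.Theorems.PoincareLipschitzWeakJacobianIdentity (integrable_mul_of_L2)
open Summit.QuantumFields.YangMills.Theorems.PoincareLipschitzHSystemEnergyIdentityLetters
open Summit.QuantumFields.YangMills.Theorems.PoincareLipschitzHSystemEnergyIdentityCutoff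

/-! ## §3 The energy identity for one scalar component -/

/-- ★★ **THE ENERGY IDENTITY FOR A SCALAR ROW.**  Let `u : E² → ℝ` be continuous with `|u| ≤ M` and weakly differentiable on the
plane with `∂_k u ∈ L²`, and let `J ∈ L¹` satisfy `−∫ Σ_k ∂_kη ∂_k u = 2∫ η J` for every smooth compactly supported `η`.  Then for
EVERY constant `c`:  `∫ Σ_k (∂_k u)² = −2 ∫ (u − c) J`.
(File 1's localised row with `χ = χ₁((n+1)⁻¹·)`; the cross term is `≤ 2(M+|c|)‖∇χ₁‖₂ · (energy tail)^{1/2} → 0` by §2, the other two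
terms converge by dominated convergence.) [cite: Wente1969, §2; BrezisCoron1985, Appendix, proof of Lemma A.1] -/
theorem energy_identity_scalar {u : EuclideanSpace ℝ (Fin 2) → ℝ} {Gu : EuclideanSpace ℝ (Fin 2) → (EuclideanSpace ℝ (Fin 2) →L[ℝ] ℝ)}
    (hu : HasWeakFDerivOn ⟨Set.univ, isOpen_univ⟩ volume u Gu) (huc : Continuous u) {M : ℝ} (huM : ∀ y, |u y| ≤ M)
    (hGu : ∀ k : Fin 2, MemLp (fun y => Gu y (EuclideanSpace.single k (1:ℝ))) 2 volume)
    {J : EuclideanSpace ℝ (Fin 2) → ℝ} (hJ : Integrable J volume)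
    (hrow : ∀ (η : EuclideanSpace ℝ (Fin 2) → ℝ), ContDiff ℝ ∞ η → HasCompactSupport η →
      -(∫ y, ∑ k : Fin 2, fderiv ℝ η y (EuclideanSpace.single k (1:ℝ)) * Gu y (EuclideanSpace.single k (1:ℝ))) = 2 * ∫ y, η y * J y)
    (c : ℝ) :
    ∫ y, ∑ k : Fin 2, (Gu y (EuclideanSpace.single k (1:ℝ))) ^ 2 = -2 * ∫ y, (u y - c) * J y := by
  set e : Fin 2 → EuclideanSpace ℝ (Fin 2) := fun k => EuclideanSpace.single k (1:ℝ) with hedef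
  -- the cut-offs `χ_n = χ₁((n+1)⁻¹ ·)`, `χ₁` the bump with radii `1 < 2`
  set χ₁ : ContDiffBump (0 : EuclideanSpace ℝ (Fin 2)) := ⟨1, 2, one_pos, one_lt_two⟩ with hχ₁
  have hr1 : χ₁.rIn = 1 := rfl
  set χ : ℕ → EuclideanSpace ℝ (Fin 2) → ℝ := fun n y => χ₁ (((n : ℝ) + 1)⁻¹ • y) with hχdef
  have hRpos : ∀ n : ℕ, (0 : ℝ) < (n : ℝ) + 1 := fun n => by positivity
  -- file 1 for each `n`
  have loc : ∀ n, -(∫ y, ∑ k : Fin 2, (2 * χ n y * fderiv ℝ (χ n) y (e k) * (u y - c) + χ n y ^ 2 * Gu y (e k)) * Gu y (e k)) =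
      2 * ∫ y, χ n y ^ 2 * (u y - c) * J y :=
    fun n => localised_row hu huc huM hGu hGu hJ hrow (contDiff_scaledCutoff χ₁ _) (hasCompactSupport_scaledCutoff χ₁ (hRpos n)) c
  -- integrability letters
  have hGi : ∀ k, Integrable (fun y => Gu y (e k) ^ 2) volume := fun k => (hGu k).integrable_sq
  have hpκ : ∀ y, |u y - c| ≤ M + |c| := fun y => (abs_sub _ _).trans (add_le_add (huM y) le_rfl)
  have intX : ∀ n k, Integrable (fun y => 2 * χ n y * fderiv ℝ (χ n) y (e k) * (u y - c) * Gu y (e k)) volume := by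
    intro n k
    have hc' : Continuous fun y => 2 * χ n y * fderiv ℝ (χ n) y (e k) * (u y - c) :=
      ((continuous_const.mul (contDiff_scaledCutoff χ₁ _).continuous).mul
        (((contDiff_scaledCutoff χ₁ _).continuous_fderiv (by simp)).clm_apply continuous_const)).mul (huc.sub continuous_const)
    have hs' : HasCompactSupport fun y => 2 * χ n y * fderiv ℝ (χ n) y (e k) * (u y - c) :=
      (((hasCompactSupport_scaledCutoff χ₁ (hRpos n)).fderiv_apply (𝕜 := ℝ) (e k)).mul_left (f := fun y => 2 * χ n y)).mul_right
    exact integrable_mul_of_L2 (hc'.memLp_of_hasCompactSupport hs') (hGu k)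
  have intY : ∀ n k, Integrable (fun y => χ n y ^ 2 * Gu y (e k) ^ 2) volume := by
    intro n k
    refine (hGi k).bdd_mul (c := 1) (((contDiff_scaledCutoff χ₁ _).continuous.pow 2).aestronglyMeasurable)
      (Eventually.of_forall fun y => ?_)
    obtain ⟨h0, h1⟩ := scaledCutoff_mem_Icc χ₁ ((n : ℝ) + 1) y
    rw [Real.norm_eq_abs, abs_pow, abs_of_nonneg h0]
    exact pow_le_one₀ h0 h1
  -- split the left-hand side of `loc n`
  have lhs : ∀ n, ∫ y, ∑ k : Fin 2, (2 * χ n y * fderiv ℝ (χ n) y (e k) * (u y - c) + χ n y ^ 2 * Gu y (e k)) * Gu y (e k) =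
      ∑ k : Fin 2, ((∫ y, 2 * χ n y * fderiv ℝ (χ n) y (e k) * (u y - c) * Gu y (e k)) + ∫ y, χ n y ^ 2 * Gu y (e k) ^ 2) := by
    intro n
    have hF : ∀ k, (fun y => (2 * χ n y * fderiv ℝ (χ n) y (e k) * (u y - c) + χ n y ^ 2 * Gu y (e k)) * Gu y (e k)) =
        fun y => 2 * χ n y * fderiv ℝ (χ n) y (e k) * (u y - c) * Gu y (e k) + χ n y ^ 2 * Gu y (e k) ^ 2 := by
      intro k; funext y; ring
    rw [integral_finsetSum _ (fun k _ => by rw [hF k]; exact (intX n k).add (intY n k))]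
    refine Finset.sum_congr rfl fun k _ => ?_
    rw [hF k, integral_add (intX n k) (intY n k)]
  -- (X) the cross terms tend to `0`
  have limX : ∀ k, Tendsto (fun n => ∫ y, 2 * χ n y * fderiv ℝ (χ n) y (e k) * (u y - c) * Gu y (e k)) atTop (𝓝 0) := by
    intro k
    have htail := tendsto_setIntegral_tail (hGi k) (r := χ₁.rIn) (by rw [hr1]; exact one_pos)
    have hsq : Tendsto (fun n : ℕ => 2 * (M + |c|) * Real.sqrt (∫ z, (fderiv ℝ χ₁ z (e k)) ^ 2) *
        Real.sqrt (∫ y in {y : EuclideanSpace ℝ (Fin 2) | χ₁.rIn * ((n : ℝ) + 1) ≤ ‖y‖}, Gu y (e k) ^ 2)) atTop (𝓝 0) := by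
      have := (Real.continuous_sqrt.tendsto 0).comp htail
      rw [Function.comp_def, Real.sqrt_zero] at this
      simpa only [mul_zero] using this.const_mul (2 * (M + |c|) * Real.sqrt (∫ z, (fderiv ℝ χ₁ z (e k)) ^ 2))
    refine squeeze_zero_norm (fun n => ?_) hsq
    rw [Real.norm_eq_abs]
    exact abs_integral_cross_le χ₁ (hRpos n) (e k) hpκ (hGu k)
  -- (Y) the energy terms converge by dominated convergence
  have hχlim : ∀ y, ∀ᶠ n : ℕ in atTop, χ n y = 1 := by
    intro y
    obtain ⟨N, hN⟩ := exists_nat_ge ‖y‖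
    filter_upwards [eventually_ge_atTop N] with n hn
    refine scaledCutoff_eq_one χ₁ (hRpos n) ?_
    rw [hr1, one_mul]
    exact hN.trans (by exact_mod_cast Nat.le_succ_of_le hn)
  have limY : ∀ k, Tendsto (fun n => ∫ y, χ n y ^ 2 * Gu y (e k) ^ 2) atTop (𝓝 (∫ y, Gu y (e k) ^ 2)) := by
    intro k
    refine tendsto_integral_of_dominated_convergence _ (fun n => (intY n k).aestronglyMeasurable) (hGi k)
      (fun n => Eventually.of_forall fun y => ?_) (Eventually.of_forall fun y => ?_)
    · obtain ⟨h0, h1⟩ := scaledCutoff_mem_Icc χ₁ ((n : ℝ) + 1) y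
      rw [Real.norm_eq_abs, abs_mul, abs_pow, abs_of_nonneg h0, abs_of_nonneg (sq_nonneg _)]
      exact mul_le_of_le_one_left (sq_nonneg _) (pow_le_one₀ h0 h1)
    · refine tendsto_nhds_of_eventually_eq ?_
      filter_upwards [hχlim y] with n hn
      rw [hn, one_pow, one_mul]
  -- (Z) the right-hand side converges by dominated convergence
  have limZ : Tendsto (fun n => 2 * ∫ y, χ n y ^ 2 * (u y - c) * J y) atTop (𝓝 (2 * ∫ y, (u y - c) * J y)) := by
    refine Tendsto.const_mul 2 ?_
    refine tendsto_integral_of_dominated_convergence (fun y => (M + |c|) * |J y|) (fun n => ?_) ((hJ.abs).const_mul _)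
      (fun n => Eventually.of_forall fun y => ?_) (Eventually.of_forall fun y => ?_)
    · exact ((((contDiff_scaledCutoff χ₁ _).continuous.pow 2).mul (huc.sub continuous_const)).aestronglyMeasurable).mul
        hJ.aestronglyMeasurable
    · obtain ⟨h0, h1⟩ := scaledCutoff_mem_Icc χ₁ ((n : ℝ) + 1) y
      rw [Real.norm_eq_abs, abs_mul, abs_mul, abs_pow, abs_of_nonneg h0]
      calc χ n y ^ 2 * |u y - c| * |J y| ≤ 1 * (M + |c|) * |J y| := by
            gcongr
            · exact pow_le_one₀ h0 h1
            · exact hpκ y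
        _ = (M + |c|) * |J y| := by ring
    · refine tendsto_nhds_of_eventually_eq ?_
      filter_upwards [hχlim y] with n hn
      rw [hn, one_pow, one_mul]
  -- conclude
  have hL : Tendsto (fun n => -(∑ k : Fin 2, ((∫ y, 2 * χ n y * fderiv ℝ (χ n) y (e k) * (u y - c) * Gu y (e k)) +
      ∫ y, χ n y ^ 2 * Gu y (e k) ^ 2))) atTop (𝓝 (-(∑ k : Fin 2, ((0 : ℝ) + ∫ y, Gu y (e k) ^ 2)))) :=
    (tendsto_finsetSum _ fun k _ => (limX k).add (limY k)).neg
  have hL' : Tendsto (fun n => -(∑ k : Fin 2, ((∫ y, 2 * χ n y * fderiv ℝ (χ n) y (e k) * (u y - c) * Gu y (e k)) +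
      ∫ y, χ n y ^ 2 * Gu y (e k) ^ 2))) atTop (𝓝 (2 * ∫ y, (u y - c) * J y)) := by
    refine limZ.congr fun n => ?_
    rw [← loc n, lhs n]
  have key := tendsto_nhds_unique hL hL'
  simp only [zero_add] at key
  rw [integral_finsetSum _ fun k _ => hGi k]
  linarith

/-! ## §4 The `H`-system: energy identity and the (W-EN) row -/

section HSystem

variable {B : EuclideanSpace ℝ (Fin 2) → EuclideanSpace ℝ (Fin 3)}
  {GB : EuclideanSpace ℝ (Fin 2) → (EuclideanSpace ℝ (Fin 2) →L[ℝ] EuclideanSpace ℝ (Fin 3))}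

/-- Coordinates of a continuous map are continuous. [folklore] -/
theorem continuous_coord (hBc : Continuous B) (a : Fin 3) : Continuous fun y => B y a := by
  have := (EuclideanSpace.proj (𝕜 := ℝ) a).continuous.comp hBc
  simpa only [Function.comp_def, PiLp.proj_apply] using this

/-- Coordinates are bounded by the norm: `|B y a| ≤ ‖B y‖`. [folklore] -/
theorem abs_coord_le_norm (y : EuclideanSpace ℝ (Fin 2)) (a : Fin 3) : |B y a| ≤ ‖B y‖ := by
  rw [← Real.norm_eq_abs]; exact PiLp.norm_apply_le (B y) a

/-- The coordinate `B^a` has the weak gradient `(proj_a) ∘ GB` (weak derivatives commute with continuous linear maps). [folklore] -/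
theorem hasWeakFDerivOn_coord (hB : HasWeakFDerivOn ⟨Set.univ, isOpen_univ⟩ volume B GB) (a : Fin 3) :
    HasWeakFDerivOn (⟨Set.univ, isOpen_univ⟩ : Opens (EuclideanSpace ℝ (Fin 2))) volume (fun y => B y a)
      (fun y => (EuclideanSpace.proj a).comp (GB y)) := by
  have := hB.clm_comp (EuclideanSpace.proj a)
  simpa only [PiLp.proj_apply] using this

/-- Measurability of the weak gradient on the plane. [folklore] -/
theorem aestronglyMeasurable_grad (hB : HasWeakFDerivOn ⟨Set.univ, isOpen_univ⟩ volume B GB) :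
    AEStronglyMeasurable GB volume := by
  have := hB.locallyIntegrableOn_deriv.aestronglyMeasurable
  simpa only [Opens.coe_mk, Measure.restrict_univ] using this

/-- Finite energy ⇒ every `GB e_k ∈ L²`. [folklore] -/
theorem memLp_grad_apply (hB : HasWeakFDerivOn ⟨Set.univ, isOpen_univ⟩ volume B GB)
    (hE : Integrable (fun y => ∑ k : Fin 2, ‖GB y (EuclideanSpace.single k (1:ℝ))‖ ^ 2)) (k : Fin 2) :
    MemLp (fun y => GB y (EuclideanSpace.single k (1:ℝ))) 2 volume := by
  have hm : AEStronglyMeasurable (fun y => GB y (EuclideanSpace.single k (1:ℝ))) volume :=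
    (ContinuousLinearMap.apply ℝ (EuclideanSpace ℝ (Fin 3)) (EuclideanSpace.single k (1:ℝ))).continuous
      |>.comp_aestronglyMeasurable (aestronglyMeasurable_grad hB)
  refine (memLp_two_iff_integrable_sq_norm hm).2 (hE.mono (hm.norm.pow 2) (Eventually.of_forall fun y => ?_))
  rw [Real.norm_eq_abs, Real.norm_eq_abs, abs_of_nonneg (by positivity), abs_of_nonneg (Finset.sum_nonneg fun i _ => by positivity)]
  exact Finset.single_le_sum (f := fun i => ‖GB y (EuclideanSpace.single i (1:ℝ))‖ ^ 2) (fun i _ => by positivity) (Finset.mem_univ k)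

/-- Finite energy ⇒ every Jacobian entry `(GB e_k)^a ∈ L²`. [folklore] -/
theorem memLp_grad_coord (hB : HasWeakFDerivOn ⟨Set.univ, isOpen_univ⟩ volume B GB)
    (hE : Integrable (fun y => ∑ k : Fin 2, ‖GB y (EuclideanSpace.single k (1:ℝ))‖ ^ 2)) (k : Fin 2) (a : Fin 3) :
    MemLp (fun y => (GB y (EuclideanSpace.single k (1:ℝ))) a) 2 volume := by
  have := (EuclideanSpace.proj a : EuclideanSpace ℝ (Fin 3) →L[ℝ] ℝ).comp_memLp' (memLp_grad_apply hB hE k)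
  simpa [Function.comp_def] using this

/-- Finite energy ⇒ the Jacobian densities `(B_x ∧ B_y)^a ∈ L¹`. [folklore] -/
theorem integrable_jacobian (hB : HasWeakFDerivOn ⟨Set.univ, isOpen_univ⟩ volume B GB)
    (hE : Integrable (fun y => ∑ k : Fin 2, ‖GB y (EuclideanSpace.single k (1:ℝ))‖ ^ 2)) (a : Fin 3) :
    Integrable (fun y => (GB y (EuclideanSpace.single 0 (1:ℝ))) (a + 1) * (GB y (EuclideanSpace.single 1 (1:ℝ))) (a + 2) -
      (GB y (EuclideanSpace.single 0 (1:ℝ))) (a + 2) * (GB y (EuclideanSpace.single 1 (1:ℝ))) (a + 1)) volume :=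
  (integrable_mul_of_L2 (memLp_grad_coord hB hE 0 (a + 1)) (memLp_grad_coord hB hE 1 (a + 2))).sub
    (integrable_mul_of_L2 (memLp_grad_coord hB hE 0 (a + 2)) (memLp_grad_coord hB hE 1 (a + 1)))

/-- ★★★ **THE `H`-SYSTEM ENERGY IDENTITY, ONE COORDINATE.**  Let `B : E² → E³` be CONTINUOUS and BOUNDED with (F) rows (i) a weak gradient
`GB` on the plane, (ii) finite energy `Σ_k ‖GB e_k‖² ∈ L¹`, (iii) the weak `H`-system `−∫ Σ_k ∂_kη (GB e_k)^a = 2∫ η (B_x ∧ B_y)^a` for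
all smooth compactly supported `η` and all `a`.  Then for every `a` and EVERY constant `c`:
`∫ Σ_k ((GB e_k)^a)² = −2 ∫ (B^a − c) (B_x ∧ B_y)^a`. [cite: Wente1969, §2; BrezisCoron1985, Appendix, proof of Lemma A.1] -/
theorem energy_identity_coord (hB : HasWeakFDerivOn ⟨Set.univ, isOpen_univ⟩ volume B GB)
    (hE : Integrable (fun y => ∑ k : Fin 2, ‖GB y (EuclideanSpace.single k (1:ℝ))‖ ^ 2))
    (hH : ∀ (η : EuclideanSpace ℝ (Fin 2) → ℝ), ContDiff ℝ ∞ η → HasCompactSupport η → ∀ a : Fin 3,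
      -(∫ y, ∑ k : Fin 2, fderiv ℝ η y (EuclideanSpace.single k (1:ℝ)) * (GB y (EuclideanSpace.single k (1:ℝ))) a) =
        2 * ∫ y, η y * ((GB y (EuclideanSpace.single 0 (1:ℝ))) (a + 1) * (GB y (EuclideanSpace.single 1 (1:ℝ))) (a + 2) -
          (GB y (EuclideanSpace.single 0 (1:ℝ))) (a + 2) * (GB y (EuclideanSpace.single 1 (1:ℝ))) (a + 1)))
    (hBc : Continuous B) {M : ℝ} (hBM : ∀ y, ‖B y‖ ≤ M) (a : Fin 3) (c : ℝ) :
    ∫ y, ∑ k : Fin 2, ((GB y (EuclideanSpace.single k (1:ℝ))) a) ^ 2 =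
      -2 * ∫ y, (B y a - c) * ((GB y (EuclideanSpace.single 0 (1:ℝ))) (a + 1) * (GB y (EuclideanSpace.single 1 (1:ℝ))) (a + 2) -
        (GB y (EuclideanSpace.single 0 (1:ℝ))) (a + 2) * (GB y (EuclideanSpace.single 1 (1:ℝ))) (a + 1)) := by
  have h := energy_identity_scalar (u := fun y => B y a) (Gu := fun y => (EuclideanSpace.proj a).comp (GB y))
    (hasWeakFDerivOn_coord hB a) (continuous_coord hBc a) (M := M) (fun y => (abs_coord_le_norm y a).trans (hBM y))
    (fun k => by simpa only [ContinuousLinearMap.comp_apply, PiLp.proj_apply] using memLp_grad_coord hB hE k a)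
    (integrable_jacobian hB hE a)
    (fun η hη hηc => by simpa only [ContinuousLinearMap.comp_apply, PiLp.proj_apply] using hH η hη hηc a) c
  simpa only [ContinuousLinearMap.comp_apply, PiLp.proj_apply] using h

/-- ★★★ **THE `H`-SYSTEM ENERGY IDENTITY** `Θ := ∫ Σ_k ‖GB e_k‖² = −2 Σ_a ∫ (B^a − c_a)(B_x ∧ B_y)^a` for every `c : E³` (under the
hypotheses of `energy_identity_coord`). [cite: Wente1969, §2; BrezisCoron1985, Appendix, proof of Lemma A.1] -/
theorem energy_identity (hB : HasWeakFDerivOn ⟨Set.univ, isOpen_univ⟩ volume B GB)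
    (hE : Integrable (fun y => ∑ k : Fin 2, ‖GB y (EuclideanSpace.single k (1:ℝ))‖ ^ 2))
    (hH : ∀ (η : EuclideanSpace ℝ (Fin 2) → ℝ), ContDiff ℝ ∞ η → HasCompactSupport η → ∀ a : Fin 3,
      -(∫ y, ∑ k : Fin 2, fderiv ℝ η y (EuclideanSpace.single k (1:ℝ)) * (GB y (EuclideanSpace.single k (1:ℝ))) a) =
        2 * ∫ y, η y * ((GB y (EuclideanSpace.single 0 (1:ℝ))) (a + 1) * (GB y (EuclideanSpace.single 1 (1:ℝ))) (a + 2) -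
          (GB y (EuclideanSpace.single 0 (1:ℝ))) (a + 2) * (GB y (EuclideanSpace.single 1 (1:ℝ))) (a + 1)))
    (hBc : Continuous B) {M : ℝ} (hBM : ∀ y, ‖B y‖ ≤ M) (c : EuclideanSpace ℝ (Fin 3)) :
    ∫ y, ∑ k : Fin 2, ‖GB y (EuclideanSpace.single k (1:ℝ))‖ ^ 2 =
      -2 * ∑ a : Fin 3, ∫ y, (B y a - c a) * ((GB y (EuclideanSpace.single 0 (1:ℝ))) (a + 1) * (GB y (EuclideanSpace.single 1 (1:ℝ))) (a + 2) -
        (GB y (EuclideanSpace.single 0 (1:ℝ))) (a + 2) * (GB y (EuclideanSpace.single 1 (1:ℝ))) (a + 1)) := by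
  have hsq : ∀ y, ∑ k : Fin 2, ‖GB y (EuclideanSpace.single k (1:ℝ))‖ ^ 2 =
      ∑ a : Fin 3, ∑ k : Fin 2, ((GB y (EuclideanSpace.single k (1:ℝ))) a) ^ 2 := by
    intro y
    rw [Finset.sum_comm]
    refine Finset.sum_congr rfl fun k _ => ?_
    rw [EuclideanSpace.norm_sq_eq]
    refine Finset.sum_congr rfl fun a _ => ?_
    rw [Real.norm_eq_abs, sq_abs]
  have hint : ∀ a : Fin 3, Integrable (fun y => ∑ k : Fin 2, ((GB y (EuclideanSpace.single k (1:ℝ))) a) ^ 2) volume :=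
    fun a => integrable_finsetSum _ fun k _ => (memLp_grad_coord hB hE k a).integrable_sq
  simp_rw [hsq]
  rw [integral_finsetSum _ fun a _ => hint a, Finset.mul_sum]
  exact Finset.sum_congr rfl fun a _ => energy_identity_coord hB hE hH hBc hBM a (c a)

/-- ★★★ **THE (W-EN) ROW** consumed by W-ALG: under the hypotheses of `energy_identity_coord` with `B` continuous and componentwise
oscillation bounds `|B^a − c_a| ≤ κ_a` (so `B` is bounded),  `Θ = ∫ Σ_k ‖GB e_k‖² ≤ 2 Σ_a κ_a ∫ |(B_x ∧ B_y)^a|`.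
[cite: Wente1969, §2; BrezisCoron1985, Appendix, proof of Lemma A.1] -/
theorem energy_le (hB : HasWeakFDerivOn ⟨Set.univ, isOpen_univ⟩ volume B GB)
    (hE : Integrable (fun y => ∑ k : Fin 2, ‖GB y (EuclideanSpace.single k (1:ℝ))‖ ^ 2))
    (hH : ∀ (η : EuclideanSpace ℝ (Fin 2) → ℝ), ContDiff ℝ ∞ η → HasCompactSupport η → ∀ a : Fin 3,
      -(∫ y, ∑ k : Fin 2, fderiv ℝ η y (EuclideanSpace.single k (1:ℝ)) * (GB y (EuclideanSpace.single k (1:ℝ))) a) =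
        2 * ∫ y, η y * ((GB y (EuclideanSpace.single 0 (1:ℝ))) (a + 1) * (GB y (EuclideanSpace.single 1 (1:ℝ))) (a + 2) -
          (GB y (EuclideanSpace.single 0 (1:ℝ))) (a + 2) * (GB y (EuclideanSpace.single 1 (1:ℝ))) (a + 1)))
    (hBc : Continuous B) {c : EuclideanSpace ℝ (Fin 3)} {κ : Fin 3 → ℝ} (hκ : ∀ a y, |B y a - c a| ≤ κ a) :
    ∫ y, ∑ k : Fin 2, ‖GB y (EuclideanSpace.single k (1:ℝ))‖ ^ 2 ≤
      2 * ∑ a : Fin 3, κ a * ∫ y, |(GB y (EuclideanSpace.single 0 (1:ℝ))) (a + 1) * (GB y (EuclideanSpace.single 1 (1:ℝ))) (a + 2) -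
        (GB y (EuclideanSpace.single 0 (1:ℝ))) (a + 2) * (GB y (EuclideanSpace.single 1 (1:ℝ))) (a + 1)| := by
  -- `B` is bounded
  have hco : ∀ y a, ‖B y a‖ ≤ κ a + |c a| := fun y a => by
    rw [Real.norm_eq_abs]
    calc |B y a| = |(B y a - c a) + c a| := by rw [sub_add_cancel]
      _ ≤ |B y a - c a| + |c a| := abs_add_le _ _
      _ ≤ κ a + |c a| := add_le_add (hκ a y) le_rfl
  have hBM : ∀ y, ‖B y‖ ≤ Real.sqrt (∑ a : Fin 3, (κ a + |c a|) ^ 2) := fun y => by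
    rw [EuclideanSpace.norm_eq]
    exact Real.sqrt_le_sqrt (Finset.sum_le_sum fun a _ => pow_le_pow_left₀ (norm_nonneg _) (hco y a) 2)
  rw [energy_identity hB hE hH hBc hBM c, Finset.mul_sum, Finset.mul_sum]
  refine Finset.sum_le_sum fun a _ => ?_
  have hJ := integrable_jacobian hB hE a
  have hprod : Integrable (fun y => (B y a - c a) * ((GB y (EuclideanSpace.single 0 (1:ℝ))) (a + 1) *
      (GB y (EuclideanSpace.single 1 (1:ℝ))) (a + 2) - (GB y (EuclideanSpace.single 0 (1:ℝ))) (a + 2) *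
      (GB y (EuclideanSpace.single 1 (1:ℝ))) (a + 1))) volume :=
    hJ.bdd_mul ((continuous_coord hBc a).sub continuous_const).aestronglyMeasurable
      (Eventually.of_forall fun y => by rw [Real.norm_eq_abs]; exact hκ a y)
  have h1 := abs_integral_le_integral_abs (μ := volume) (f := fun y => (B y a - c a) *
    ((GB y (EuclideanSpace.single 0 (1:ℝ))) (a + 1) * (GB y (EuclideanSpace.single 1 (1:ℝ))) (a + 2) -
      (GB y (EuclideanSpace.single 0 (1:ℝ))) (a + 2) * (GB y (EuclideanSpace.single 1 (1:ℝ))) (a + 1)))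
  have h2 : ∫ y, |(B y a - c a) * ((GB y (EuclideanSpace.single 0 (1:ℝ))) (a + 1) * (GB y (EuclideanSpace.single 1 (1:ℝ))) (a + 2) -
      (GB y (EuclideanSpace.single 0 (1:ℝ))) (a + 2) * (GB y (EuclideanSpace.single 1 (1:ℝ))) (a + 1))| ≤
      κ a * ∫ y, |(GB y (EuclideanSpace.single 0 (1:ℝ))) (a + 1) * (GB y (EuclideanSpace.single 1 (1:ℝ))) (a + 2) -
        (GB y (EuclideanSpace.single 0 (1:ℝ))) (a + 2) * (GB y (EuclideanSpace.single 1 (1:ℝ))) (a + 1)| := by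
    rw [← integral_const_mul]
    refine integral_mono hprod.abs (hJ.abs.const_mul _) fun y => ?_
    simp only [abs_mul]
    exact mul_le_mul_of_nonneg_right (hκ a y) (abs_nonneg _)
  have h3 := neg_abs_le (∫ y, (B y a - c a) * ((GB y (EuclideanSpace.single 0 (1:ℝ))) (a + 1) *
    (GB y (EuclideanSpace.single 1 (1:ℝ))) (a + 2) - (GB y (EuclideanSpace.single 0 (1:ℝ))) (a + 2) *
    (GB y (EuclideanSpace.single 1 (1:ℝ))) (a + 1)))
  linarith

end HSystem

/-! ## §5 The frozen letters of ROAD (W) (★w3-19936 g16, 16:45:59Z): `c : Fin 3 → ℝ`, `∃ M`, and the `hEn` row -/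

section Frozen

variable {B : EuclideanSpace ℝ (Fin 2) → EuclideanSpace ℝ (Fin 3)}
  {GB : EuclideanSpace ℝ (Fin 2) → (EuclideanSpace ℝ (Fin 2) →L[ℝ] EuclideanSpace ℝ (Fin 3))}

/-- ★★★ **THE `H`-SYSTEM ENERGY IDENTITY, FROZEN SHAPE**: under (F) rows (i)(ii)(iii), `Continuous B` and `∃ M, ∀ y, ‖B y‖ ≤ M`, for EVERY
`c : Fin 3 → ℝ`:  `∫ Σ_k ‖GB e_k‖² = −2 Σ_a ∫ (B^a − c_a)(B_x ∧ B_y)^a`. [cite: Wente1969, §2; BrezisCoron1985, Appendix, proof of Lemma A.1] -/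
theorem energy_identity_fun (hB : HasWeakFDerivOn ⟨Set.univ, isOpen_univ⟩ volume B GB)
    (hE : Integrable (fun y => ∑ k : Fin 2, ‖GB y (EuclideanSpace.single k (1:ℝ))‖ ^ 2))
    (hH : ∀ (η : EuclideanSpace ℝ (Fin 2) → ℝ), ContDiff ℝ ∞ η → HasCompactSupport η → ∀ a : Fin 3,
      -(∫ y, ∑ k : Fin 2, fderiv ℝ η y (EuclideanSpace.single k (1:ℝ)) * (GB y (EuclideanSpace.single k (1:ℝ))) a) =
        2 * ∫ y, η y * ((GB y (EuclideanSpace.single 0 (1:ℝ))) (a + 1) * (GB y (EuclideanSpace.single 1 (1:ℝ))) (a + 2) -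
          (GB y (EuclideanSpace.single 0 (1:ℝ))) (a + 2) * (GB y (EuclideanSpace.single 1 (1:ℝ))) (a + 1)))
    (hBc : Continuous B) (hBb : ∃ M : ℝ, ∀ y, ‖B y‖ ≤ M) (c : Fin 3 → ℝ) :
    ∫ y, ∑ k : Fin 2, ‖GB y (EuclideanSpace.single k (1:ℝ))‖ ^ 2 =
      -2 * ∑ a : Fin 3, ∫ y, (B y a - c a) * ((GB y (EuclideanSpace.single 0 (1:ℝ))) (a + 1) * (GB y (EuclideanSpace.single 1 (1:ℝ))) (a + 2) -
        (GB y (EuclideanSpace.single 0 (1:ℝ))) (a + 2) * (GB y (EuclideanSpace.single 1 (1:ℝ))) (a + 1)) := by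
  obtain ⟨M, hBM⟩ := hBb
  have h := energy_identity hB hE hH hBc hBM (WithLp.toLp 2 c)
  simpa only [WithLp.ofLp_toLp] using h

/-- ★★★ **THE `hEn` ROW OF ROAD (W), FROZEN SHAPE** (W-ALG's hypothesis, ★w3-19936 g16 16:45:59Z, token for token): under (F) rows (i)(ii)(iii),
`Continuous B` and `∃ M, ∀ y, ‖B y‖ ≤ M`, for every `c : Fin 3 → ℝ`:
`∫ Σ_k ‖GB e_k‖² ≤ 2 Σ_a |∫ (B^a − c_a)(B_x ∧ B_y)^a|`. [cite: Wente1969, §2; BrezisCoron1985, Appendix, proof of Lemma A.1] -/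
theorem energy_le_abs (hB : HasWeakFDerivOn ⟨Set.univ, isOpen_univ⟩ volume B GB)
    (hE : Integrable (fun y => ∑ k : Fin 2, ‖GB y (EuclideanSpace.single k (1:ℝ))‖ ^ 2))
    (hH : ∀ (η : EuclideanSpace ℝ (Fin 2) → ℝ), ContDiff ℝ ∞ η → HasCompactSupport η → ∀ a : Fin 3,
      -(∫ y, ∑ k : Fin 2, fderiv ℝ η y (EuclideanSpace.single k (1:ℝ)) * (GB y (EuclideanSpace.single k (1:ℝ))) a) =
        2 * ∫ y, η y * ((GB y (EuclideanSpace.single 0 (1:ℝ))) (a + 1) * (GB y (EuclideanSpace.single 1 (1:ℝ))) (a + 2) -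
          (GB y (EuclideanSpace.single 0 (1:ℝ))) (a + 2) * (GB y (EuclideanSpace.single 1 (1:ℝ))) (a + 1)))
    (hBc : Continuous B) (hBb : ∃ M : ℝ, ∀ y, ‖B y‖ ≤ M) (c : Fin 3 → ℝ) :
    ∫ y, ∑ k : Fin 2, ‖GB y (EuclideanSpace.single k (1:ℝ))‖ ^ 2 ≤
      2 * ∑ a : Fin 3, |∫ y, (B y a - c a) * ((GB y (EuclideanSpace.single 0 (1:ℝ))) (a + 1) * (GB y (EuclideanSpace.single 1 (1:ℝ))) (a + 2) -
        (GB y (EuclideanSpace.single 0 (1:ℝ))) (a + 2) * (GB y (EuclideanSpace.single 1 (1:ℝ))) (a + 1))| := by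
  rw [energy_identity_fun hB hE hH hBc hBb c, Finset.mul_sum, Finset.mul_sum]
  refine Finset.sum_le_sum fun a _ => ?_
  linarith [neg_le_abs (∫ y, (B y a - c a) * ((GB y (EuclideanSpace.single 0 (1:ℝ))) (a + 1) *
    (GB y (EuclideanSpace.single 1 (1:ℝ))) (a + 2) - (GB y (EuclideanSpace.single 0 (1:ℝ))) (a + 2) *
    (GB y (EuclideanSpace.single 1 (1:ℝ))) (a + 1)))]

end Frozen

end Summit.QuantumFields.YangMills.Theorems.PoincareLipschitzHSystemEnergyIdentity
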